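import Literature.Topology.FourManifolds.KirbyMovesSlideEndStepB
import Literature.Topology.FourManifolds.BandCoreTransport
import Literature.Topology.FourManifolds.LinkTubularUniqueness
import HarnessLib

/-!
# Normalising the end of the slide band at the push-off: steps A and B assembled

Topic `Literature/Topology/FourManifolds`; fact seat `provefact-IsStrictHandleSlide.isSurgery`
(R. C. Kirby, *The Topology of 4-Manifolds*, LNM 1374 (1989), Ch. I §4, p. 10: the slide band
reaches the framing push-off `Kⱼ'` of `Kⱼ`; remaining content in the tree: the named fact (S)
`Literature.Topology.FourManifolds.FramedLink.IsStrictHandleSlide.slideModel`). The band-end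
normalisation used by the tree's proof programme for (S): the band core `b` from `A = Kᵢ` to
`Kⱼ' = ν.pushOff` is moved by the ambient isotopy of step A (`BandCore.exists_stepA`: rotation
of the tube about the push-off circle, after which the band leaves `Kⱼ'` radially) and then by
the ambient isotopy of step B (`BandCore.exists_stepB`: straight-line flattening in a
stereographic chart), both supported in the tube of `Kⱼ`, their ends fixing `Kⱼ'` pointwise; the moved
band is a band core from `A` to `Kⱼ'` (`BandCore.exists_comp_of_fix`) whose end is the explicit
**product-flat strip** `x ↦ ν (circlePt (thetaB x₁), (1 + (1 - x₀) κ(x₁)) • e₀)`. Proved here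
(no definitions, no named facts):

* `Literature.Topology.FourManifolds.BandCore.exists_endNorm`.

## References

* R. C. Kirby, *The Topology of 4-Manifolds*, LNM 1374, Springer (1989), Ch. I §4. [Kirby1989]
* A. Kosinski, *Differential Manifolds* (1993), Ch. III, Thm. (3.5). [Kosinski1993]
* M. W. Hirsch, *Differential Topology* (1976), Ch. 8 §1, Thm. 1.3. [HirschDT1976]
-/

open scoped Manifold ContDiff Topology
open Function Set Metric Filter

noncomputable section

namespace Literature.Topology.FourManifolds

namespace BandCore

variable [Knot.TubularNbhd.SmoothnessFacts] {A Kj : Knot} (ν : Knot.TubularNbhd Kj)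
  {avoid : Set (Metric.sphere (0 : EuclideanSpace ℝ (Fin 4)) 1)} (b : BandCore A ν.pushOff avoid)

/-- **Normalisation of the band end (steps A and B).** Let `b` be a band core from `A` to the
push-off `Kⱼ' = ν.pushOff` with `A` missing the tube `ν (S¹ × ℝ²)`; heights
`1/10 < h₁ - ε ≤ h₁ ≤ h₂ ≤ h₂ + ε < 9/10`; `τ > 0`; `pt ∉ ν (S¹ × ℝ²)`; `N₀` open with
`Kⱼ' ⊆ N₀ ⊆ ν (S¹ × ℝ²)`. Then there are ambient isotopies `HA` of `S³` (supported in
`ν {‖w - e₀‖ < τ}`, fixing `Kⱼ'` for `t ∈ [0, 1]`) and `HB` (stages `= id` off `N₀`, end fixing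
`Kⱼ'`), band cores `b₁` (band `HA 1 ∘ b.band`) and `b₂` (band `HB 1 ∘ b₁.band`) from `A` to
`Kⱼ'` with the same collar width, and `κ > 0`, such that `b₁.edgeRate > 0` on `[h₁, h₂]`, the
right-edge lifts of `b₁` and `b` agree on the circle, and on the strip
`x₀ ∈ [1 - κ, 1]`, `x₁ ∈ [h₁, h₂]`:
`b₂.band x = ν (circlePt (b₁.thetaB x₁), (1 + (1 - x₀) b₁.edgeRate x₁) • e₀)`.
[cite: Kirby1989, Ch. I §4] -/
theorem exists_endNorm (hAν : Disjoint (range ⇑ν) (range ⇑A))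
    {h₁ h₂ ε : ℝ} (hε : 0 < ε) (hlo : 10⁻¹ < h₁ - ε) (hle : h₁ ≤ h₂) (hhi : h₂ + ε < 9 / 10)
    {τ : ℝ} (hτ : 0 < τ) {pt : Metric.sphere (0 : EuclideanSpace ℝ (Fin 4)) 1} (hpt : pt ∉ range ⇑ν)
    {N₀ : Set (Metric.sphere (0 : EuclideanSpace ℝ (Fin 4)) 1)} (hN₀ : IsOpen N₀) (hPN₀ : range ⇑ν.pushOff ⊆ N₀)
    (hN₀ν : N₀ ⊆ range ⇑ν) :
    ∃ (HA : AmbientIsotopy (𝓡 3) (Metric.sphere (0 : EuclideanSpace ℝ (Fin 4)) 1))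
      (HB : AmbientIsotopy (𝓡 3) (Metric.sphere (0 : EuclideanSpace ℝ (Fin 4)) 1))
      (b₁ b₂ : BandCore A ν.pushOff ∅) (κ : ℝ),
      0 < κ ∧ b₁.band = HA.toFun 1 ∘ b.band ∧ b₂.band = HB.toFun 1 ∘ b₁.band ∧ b₁.δ = b.δ ∧ b₂.δ = b.δ ∧
      (∀ t z, z ∉ range ⇑ν → HA.toFun t z = z) ∧
      (∀ t (x : Metric.sphere (0 : EuclideanSpace ℝ (Fin 2)) 1) (w : EuclideanSpace ℝ (Fin 2)),
        τ ≤ ‖w - framingBaseVector‖ → HA.toFun t (ν (x, w)) = ν (x, w)) ∧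
      (∀ t ∈ Icc (0 : ℝ) 1, ∀ u, HA.toFun t (ν.pushOff u) = ν.pushOff u) ∧
      (∀ t z, z ∉ N₀ → HB.toFun t z = z) ∧ (∀ u, HB.toFun 1 (ν.pushOff u) = ν.pushOff u) ∧
      (∀ y ∈ Icc h₁ h₂, 0 < b₁.edgeRate ν y) ∧
      (∀ y ∈ Icc (10⁻¹ : ℝ) (9 / 10), circlePt (b₁.thetaB y) = circlePt (b.thetaB y)) ∧
      ∀ x : EuclideanSpace ℝ (Fin 2), x 0 ∈ Icc (1 - κ) 1 → x 1 ∈ Icc h₁ h₂ →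
        b₂.band x = ν (circlePt (b₁.thetaB (x 1)), (1 + (1 - x 0) * b₁.edgeRate ν (x 1)) • framingBaseVector) := by
  have hh₁ : 10⁻¹ < h₁ - ε := hlo
  have hh : h₁ - ε ≤ h₂ + ε := by linarith
  have hh₂ : h₂ + ε < 9 / 10 := hhi
  -- step A
  obtain ⟨HA, hout, hfixτ, -, hP, -, hder⟩ := b.exists_stepA ν hh₁ hh hh₂ hτ
  set ΦA := HA.toDiffeomorph 1 with hΦA
  have hAfix : ∀ u, ΦA (A u) = A u := fun u ↦ by
    rw [hΦA, AmbientIsotopy.coe_toDiffeomorph]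
    exact hout 1 _ (fun h ↦ Set.disjoint_left.1 hAν h ⟨u, rfl⟩)
  have hPfixA : ∀ u, ΦA (ν.pushOff u) = ν.pushOff u := fun u ↦ by
    rw [hΦA, AmbientIsotopy.coe_toDiffeomorph]; exact hP 1 ⟨zero_le_one, le_rfl⟩ u
  obtain ⟨b₁, hb₁, hδ₁⟩ := b.exists_comp_of_fix ΦA hAfix hPfixA
  -- the radiality of `b₁` along `[h₁ - ε, h₂ + ε]`
  have hrad : ∀ y ∈ Icc (h₁ - ε) (h₂ + ε),
      fderiv ℝ (b₁.tubeNormal ν) (pt2 1 y) (pt2 1 0) = (-b₁.edgeRate ν y) • framingBaseVector ∧ 0 < b₁.edgeRate ν y := by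
    intro y hy
    obtain ⟨c, hc, hcd⟩ := hder y hy
    have hfun : b₁.tubeNormal ν = fun x ↦ (ν.toTubeNbhd.toHomeo.symm (HA.toFun 1 (b.band x))).2 := by
      funext x
      rw [tubeNormal_def, hb₁]
      rfl
    have h1 : fderiv ℝ (b₁.tubeNormal ν) (pt2 1 y) (pt2 1 0) = (-c) • framingBaseVector := by rw [hfun]; exact hcd
    have h2 : b₁.edgeRate ν y = c := b₁.edgeRate_eq_of_fderiv_eq ν h1
    rw [h2]
    exact ⟨h1, hc⟩
  -- step B in the stereographic chart from `pt`
  set σ := stereoChart pt with hσdef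
  have hσ : ContMDiffOn (𝓡 3) 𝓘(ℝ, EuclideanSpace ℝ (Fin 3)) ∞ σ σ.source := contMDiffOn_stereoChart pt
  have hσs : ContMDiff 𝓘(ℝ, EuclideanSpace ℝ (Fin 3)) (𝓡 3) ∞ σ.symm := contMDiff_stereoChart_symm pt
  have hσt : σ.target = univ := stereoChart_target pt
  have hνσ : ∀ q, ν q ∈ σ.source := fun q ↦ by
    rw [hσdef, stereoChart_source]
    exact fun h ↦ hpt (h ▸ ⟨q, rfl⟩)
  obtain ⟨HB, κ, hκ, hBout, hBP, hflat⟩ := b₁.exists_stepB ν hσ hσs hσt hνσ hε hlo hle hhi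
    (fun y hy ↦ (hrad y hy).1) (fun y hy ↦ (hrad y hy).2) hN₀ hPN₀
  set ΦB := HB.toDiffeomorph 1 with hΦB
  have hAfixB : ∀ u, ΦB (A u) = A u := fun u ↦ by
    rw [hΦB, AmbientIsotopy.coe_toDiffeomorph]
    exact hBout 1 _ (fun h ↦ Set.disjoint_left.1 hAν (hN₀ν h) ⟨u, rfl⟩)
  have hPfixB : ∀ u, ΦB (ν.pushOff u) = ν.pushOff u := fun u ↦ by
    rw [hΦB, AmbientIsotopy.coe_toDiffeomorph]; exact hBP u
  obtain ⟨b₂, hb₂, hδ₂⟩ := b₁.exists_comp_of_fix ΦB hAfixB hPfixB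
  refine ⟨HA, HB, b₁, b₂, κ, hκ, ?_, ?_, hδ₁, hδ₂.trans hδ₁, hout, hfixτ, hP, hBout, hBP,
    fun y hy ↦ (hrad y (Icc_subset_Icc (by linarith) (by linarith) hy)).2, fun y hy ↦ ?_, fun x hx0 hx1 ↦ ?_⟩
  · rw [hb₁, hΦA, AmbientIsotopy.coe_toDiffeomorph]
  · rw [hb₂, hΦB, AmbientIsotopy.coe_toDiffeomorph]
  · -- the right-edge lifts agree on the circle
    have h1 : ν.pushOff (circlePt (b₁.thetaB y)) = b₁.band (pt2 1 y) := b₁.apply_circlePt_thetaB hy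
    have h2 : ν.pushOff (circlePt (b.thetaB y)) = b.band (pt2 1 y) := b.apply_circlePt_thetaB hy
    have h3 : b₁.band (pt2 1 y) = b.band (pt2 1 y) := by
      rw [hb₁, comp_apply, ← h2, hPfixA]
    exact ν.pushOff.injective (h1.trans (h3.trans h2.symm))
  · rw [hb₂, comp_apply, hΦB, AmbientIsotopy.coe_toDiffeomorph, hflat x hx0 hx1, b₁.thickeningFlat_zero ν]

end BandCore

end Literature.Topology.FourManifolds
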